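import Summits.CriticalPhenomena.SAWScalingLimit.Theses.SAWDeterminantalDiagonal

/-!
# `Assembly` (stmt-CriticalPhenomena-8252): the frame of route `SAWDeterminantalDiagonal`

Assembly item stmt-CriticalPhenomena-8252: `LSWSimpleRestrictionIsSLE → NeutralRestriction → RestrictionOfDiagLimit →
DiscrepancyConfCov → DiscrepancySimple → DiagonalUniversality → SAWScalingLimit` — literally the route's certified deciding
theorem `SAWDeterminantalDiagonal.closes` (same hypotheses, same order).  Nothing is asserted about the antecedents
(all research-grade items).  [cite: LawlerSchrammWerner2003Restriction, Thm 8.4]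
-/

namespace Summit.CriticalPhenomena.SAWScalingLimit.Theorems

open Summit.CriticalPhenomena.SAWScalingLimit.Theses

/-- **`Assembly` (stmt-CriticalPhenomena-8252)** of route `SAWDeterminantalDiagonal`, by the route's deciding theorem
`closes`. [cite: LawlerSchrammWerner2003Restriction, Thm 8.4] -/
theorem DetDiagAssembly_proof : SAWDeterminantalDiagonal.Assembly :=
  fun hLSW hNR hRes hCC hSimple hDU => SAWDeterminantalDiagonal.closes hLSW hNR hRes hCC hSimple hDU

end Summit.CriticalPhenomena.SAWScalingLimit.Theorems
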